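import Summits.ResolutionOfSingularities.ResolutionOfSingularities.Theses.UniversalCells
import Summits.ResolutionOfSingularities.ResolutionOfSingularities.Theorems.MatroidCellRes.Negative.ChartPresentation
import Summits.ResolutionOfSingularities.ResolutionOfSingularities.Theorems.MatroidCellRes.Negative.ChartPresentationDimension
import Literature.AlgebraicGeometry.Resolution.HuGammaSchemeResolution
import Literature.AlgebraicGeometry.Resolution.PrincipalizationToResolution
import HarnessLib

/-!
# `MatroidCellRes`, line `birth` — negative lemmas: integrality of the CHART is load-bearing in the
# residue stub (N), and `IsDomain` is load-bearing in Hu's claim (H)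

Support (negative) lemmas for crux stmt-ResolutionOfSingularities-15230
(`Summit.ResolutionOfSingularities.ResolutionOfSingularities.Theses.UniversalCells.MatroidCellRes`,
route UniversalCells, rank 2), filed by the crux disprover (cdisprove seat, generation 2), about the
two open stubs of the registered line `birth` (RESHAPE 4d, `Cruxes/MatroidCellRes/Lines/birth.lean`):

* (H) `stub_hu2025Thm13 : Literature…Hu2025IntegralGammaSchemeResolution` — Hu 2025 Thm. 1.3 by
  name: `IsDomain (𝔽_p[A] ⧸ (Γ-minors)) → ∃ Z' π, IsProper π ∧ IsBirational π ∧ Smooth (π ≫ toBase)`;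
* (N) `stub_saturatedEngineNonintegral` — the residue: for `Q_Γ = 𝔽_p[A] ⧸ (Γ-minors)` NOT a
  domain, `g : Q_Γ` with `(Q_Γ)_g` a domain (`hdom`), `Γ` saturated on `D(g)` (`hsat`), `(Q_Γ)_g`
  not regular (`hsing`), `dim Spec (Q_Γ)_g ≥ 2` (`hdim`) ⊢ `HasResolution (Spec (Q_Γ)_g)`.

## Main statements

* `stub_saturatedEngineNonintegral_false_without_hdom` — (N) with the chart-integrality hypothesis
  `hdom : IsDomain (Localization.Away g)` DROPPED is FALSE (all other hypotheses kept: `p` prime,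
  `Q_Γ` not a domain, `Γ` SATURATED on the chart, the chart singular and of dimension `≥ 2`);
  `…_at` gives the witness at every prime `p`. So in (N) — and in the strategist's saturated engine
  S⁺₁ (`Sig.saturatedEngine` of the skeleton), whose hypotheses are a subset — `hdom` is the one
  hypothesis that cannot be removed; the other four (`hnd`, `hsat`, `hsing`, `hdim`) are each
  removable under the summit (tree: `Theorems.MatroidCellRes.hasResolution_away_of_resolutionOfSingularities`,
  `saturatedEngine_of_resolutionOfSingularities`, p158618).
* `hu2025Thm13_false_without_isDomain` — Hu's claim (H) with its hypothesis `IsDomain` DROPPED is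
  FALSE: the Γ-scheme below has no proper birational `Z' → Z_Γ` with `Z'` smooth over `𝔽_p`
  (`…_at`: at every prime). Integrality is load-bearing for Hu's STATEMENT, not only for his proof
  (Lemma 7.3); under the summit it can be weakened to `IsReduced`, not removed.

## The witness (both statements)

Generation 1's non-reduced Γ-scheme (`Negative/NonReducedGammaScheme.lean`): `m = 3`,
`Γ₀ = {(c₀,c₁,c₂), (e₂,c₀,c₂), (e₁,e₂,c₂), (e₀,e₂,c₀), (e₀,e₁,c₁)}` with minors `det A`,
`a₀₀a₁₂ - a₀₂a₁₀`, `a₀₂`, `-a₁₀`, `a₂₁`; on `D(g₀)`, `g₀ = a₀₁a₂₀a₁₁a₂₂`, the Γ-scheme is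
`Spec 𝔽_p[y^±,u^±,z^±,v^±][x]/(x²)` (nowhere reduced, dimension `4`). For (N) the chart is first
SATURATED exactly as the line's glue stub (B) does (`Γ := {u | x_u = 0 in (Q_{Γ₀})_{g₀}} ⊇ Γ₀`,
`g :=` the image of `a₀₁a₂₀a₁₁a₂₂` in `Q_Γ`); saturation rescues nothing: the saturated chart ring
`T = (Q_Γ)_g` is presented by the same five relations plus the invertibility of `g` (universal
property `hlift`/`hext` below), so `Negative/ChartPresentation.lean` applies — `T` carries the
nilpotent `f = ywu` whose annihilator lies in every prime; hence `Q_Γ` is not a domain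
(`f² = 0 ≠ f`), `T` is not regular, `dim T ≥ 2` (`Negative/ChartPresentationDimension.lean`) and
`Spec T` has no resolution. For (H): the same for the unsaturated chart `L = (Q_{Γ₀})_{g₀}`, an open
subscheme of `Z_{Γ₀} = Spec (HuGamma.ring 𝔽_p 3 Γ₀)`; a proper birational `Z' → Z_{Γ₀}` with `Z'`
smooth over `𝔽_p` (hence regular) would restrict to a resolution of `Spec L`.

This file declares no definition and no notation. Folklore throughout (explicit computation).
-/

noncomputable section

-- single-problem summit: the doubled namespace component `ResolutionOfSingularities` is forced
set_option linter.dupNamespace false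

open CategoryTheory AlgebraicGeometry TopologicalSpace Literature.AlgebraicGeometry.Resolution
open MvPolynomial (X C)

namespace Summit.ResolutionOfSingularities.ResolutionOfSingularities.Theorems.MatroidCellRes.Negative

/-! ## §3 The saturated chart of the six-column example: (N) without `hdom` is false -/

section Residue

/-- **Witness, at every prime `p`, against the residue stub (N) with `hdom` dropped.** With
`m = 3`, `Γ₀` the five triples of generation 1, `g₀ = a₀₁a₂₀a₁₁a₂₂`, the SATURATED set
`Γ := {u | x_u = 0 in (Q_{Γ₀})_{g₀}} ⊇ Γ₀` and `g` the image of `a₀₁a₂₀a₁₁a₂₂` in `Q_Γ`: `Q_Γ` is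
not a domain, `Γ` is saturated on `D(g)`, the chart `(Q_Γ)_g` is not regular and has dimension
`≥ 2` — and `Spec (Q_Γ)_g` has NO resolution. The chart ring is presented by the five relations
and the unit `g` (`hlift`: a map `𝔽_p[A] → D` killing the five minors with `g₀ ↦` a unit factors
through `(Q_{Γ₀})_{g₀}`, hence kills every `x_u`, `u ∈ Γ`, hence factors through `Q_Γ` and
`(Q_Γ)_g`), so §2 applies. [folklore] -/
theorem stub_saturatedEngineNonintegral_false_without_hdom_at (p : ℕ) (hp : p.Prime) :
    ∃ (m : ℕ) (Γ : Set (Fin 3 → Fin 3 ⊕ Fin m))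
      (g : MvPolynomial (Fin 3 × Fin m) (ZMod p) ⧸ Ideal.span ((fun u : Fin 3 → Fin 3 ⊕ Fin m => ((Matrix.fromCols (1 : Matrix (Fin 3) (Fin 3) (MvPolynomial (Fin 3 × Fin m) (ZMod p))) (Matrix.of fun i j => MvPolynomial.X (i, j))).submatrix id u).det) '' Γ)),
      ¬ IsDomain (MvPolynomial (Fin 3 × Fin m) (ZMod p) ⧸ Ideal.span ((fun u : Fin 3 → Fin 3 ⊕ Fin m => ((Matrix.fromCols (1 : Matrix (Fin 3) (Fin 3) (MvPolynomial (Fin 3 × Fin m) (ZMod p))) (Matrix.of fun i j => MvPolynomial.X (i, j))).submatrix id u).det) '' Γ)) ∧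
      (∀ u : Fin 3 → Fin 3 ⊕ Fin m, u ∉ Γ →
        algebraMap (MvPolynomial (Fin 3 × Fin m) (ZMod p) ⧸ Ideal.span ((fun u : Fin 3 → Fin 3 ⊕ Fin m => ((Matrix.fromCols (1 : Matrix (Fin 3) (Fin 3) (MvPolynomial (Fin 3 × Fin m) (ZMod p))) (Matrix.of fun i j => MvPolynomial.X (i, j))).submatrix id u).det) '' Γ)) (Localization.Away g)
          (Ideal.Quotient.mk (Ideal.span ((fun u : Fin 3 → Fin 3 ⊕ Fin m => ((Matrix.fromCols (1 : Matrix (Fin 3) (Fin 3) (MvPolynomial (Fin 3 × Fin m) (ZMod p))) (Matrix.of fun i j => MvPolynomial.X (i, j))).submatrix id u).det) '' Γ))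
            ((Matrix.fromCols (1 : Matrix (Fin 3) (Fin 3) (MvPolynomial (Fin 3 × Fin m) (ZMod p))) (Matrix.of fun i j => MvPolynomial.X (i, j))).submatrix id u).det) ≠ 0) ∧
      ¬ IsRegularRing (Localization.Away g) ∧
      ¬ topologicalKrullDim (Spec (.of (Localization.Away g))) ≤ 1 ∧
      ¬ Scheme.HasResolution (Spec (.of (Localization.Away g))) := by
  classical
  haveI : Fact p.Prime := ⟨hp⟩
  refine ⟨3, ?_⟩
  -- the family of minors and generation 1's `Γ₀`
  set x : (Fin 3 → Fin 3 ⊕ Fin 3) → MvPolynomial (Fin 3 × Fin 3) (ZMod p) := fun u =>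
    ((Matrix.fromCols (1 : Matrix (Fin 3) (Fin 3) (MvPolynomial (Fin 3 × Fin 3) (ZMod p)))
      (Matrix.of fun i j => MvPolynomial.X (i, j))).submatrix id u).det with hxdef
  let Γ₀ : Set (Fin 3 → Fin 3 ⊕ Fin 3) := {![Sum.inr 0, Sum.inr 1, Sum.inr 2],
      ![Sum.inl 2, Sum.inr 0, Sum.inr 2], ![Sum.inl 1, Sum.inl 2, Sum.inr 2],
      ![Sum.inl 0, Sum.inl 2, Sum.inr 0], ![Sum.inl 0, Sum.inl 1, Sum.inr 1]}
  have hI₀ : Ideal.span (x '' Γ₀) = Ideal.span {X (0,0) * X (1,1) * X (2,2) - X (0,0) * X (1,2) * X (2,1)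
        - X (0,1) * X (1,0) * X (2,2) + X (0,1) * X (1,2) * X (2,0)
        + X (0,2) * X (1,0) * X (2,1) - X (0,2) * X (1,1) * X (2,0),
      X (0,0) * X (1,2) - X (0,2) * X (1,0), X (0,2), - X (1,0), X (2,1)} :=
    gammaIdeal_example_eq p
  have hg1 : (X (0,0) * X (1,1) * X (2,2) - X (0,0) * X (1,2) * X (2,1)
        - X (0,1) * X (1,0) * X (2,2) + X (0,1) * X (1,2) * X (2,0)
        + X (0,2) * X (1,0) * X (2,1) - X (0,2) * X (1,1) * X (2,0)) ∈ Ideal.span (x '' Γ₀) := by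
    rw [hI₀]; exact Ideal.subset_span (by simp)
  have hg2 : (X (0,0) * X (1,2) - X (0,2) * X (1,0)) ∈ Ideal.span (x '' Γ₀) := by
    rw [hI₀]; exact Ideal.subset_span (by simp)
  have hg3 : (X (0,2) : MvPolynomial (Fin 3 × Fin 3) (ZMod p)) ∈ Ideal.span (x '' Γ₀) := by
    rw [hI₀]; exact Ideal.subset_span (by simp)
  have hg4 : (X (1,0) : MvPolynomial (Fin 3 × Fin 3) (ZMod p)) ∈ Ideal.span (x '' Γ₀) := by
    rw [← neg_mem_iff, hI₀]; exact Ideal.subset_span (by simp)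
  have hg5 : (X (2,1) : MvPolynomial (Fin 3 × Fin 3) (ZMod p)) ∈ Ideal.span (x '' Γ₀) := by
    rw [hI₀]; exact Ideal.subset_span (by simp)
  -- the chart `L = (Q_{Γ₀})_{g₀}`, the saturated set `Γ`, the saturated chart `T = (Q_Γ)_g`
  let g₀ : MvPolynomial (Fin 3 × Fin 3) (ZMod p) ⧸ Ideal.span (x '' Γ₀) :=
    Ideal.Quotient.mk _ (X (0,1) * X (2,0) * X (1,1) * X (2,2))
  let Γ : Set (Fin 3 → Fin 3 ⊕ Fin 3) := {u | algebraMap (MvPolynomial (Fin 3 × Fin 3) (ZMod p) ⧸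
    Ideal.span (x '' Γ₀)) (Localization.Away g₀) (Ideal.Quotient.mk _ (x u)) = 0}
  have hΓ₀Γ : Γ₀ ⊆ Γ := fun u hu => by
    show algebraMap _ (Localization.Away g₀) (Ideal.Quotient.mk _ (x u)) = 0
    rw [Ideal.Quotient.eq_zero_iff_mem.mpr (Ideal.subset_span (Set.mem_image_of_mem x hu)),
      map_zero]
  have hII : Ideal.span (x '' Γ₀) ≤ Ideal.span (x '' Γ) := Ideal.span_mono (Set.image_mono hΓ₀Γ)
  let g : MvPolynomial (Fin 3 × Fin 3) (ZMod p) ⧸ Ideal.span (x '' Γ) :=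
    Ideal.Quotient.mk _ (X (0,1) * X (2,0) * X (1,1) * X (2,2))
  refine ⟨Γ, g, ?_⟩
  let ιT : MvPolynomial (Fin 3 × Fin 3) (ZMod p) →+* Localization.Away g :=
    (algebraMap _ (Localization.Away g)).comp (Ideal.Quotient.mk (Ideal.span (x '' Γ)))
  have hιT : ∀ a, ιT a = algebraMap (MvPolynomial (Fin 3 × Fin 3) (ZMod p) ⧸ Ideal.span (x '' Γ))
      (Localization.Away g) (Ideal.Quotient.mk (Ideal.span (x '' Γ)) a) := fun a => rfl
  have hkill : ∀ a ∈ Ideal.span (x '' Γ₀), ιT a = 0 := fun a ha => by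
    rw [hιT, Ideal.Quotient.eq_zero_iff_mem.mpr (hII ha), map_zero]
  have h1 := hkill _ hg1
  have h2 := hkill _ hg2
  have h3 := hkill _ hg3
  have h4 := hkill _ hg4
  have h5 := hkill _ hg5
  have hunit : IsUnit (ιT (X (0,1) * X (2,0) * X (1,1) * X (2,2))) :=
    IsLocalization.Away.algebraMap_isUnit g
  -- universal property of the saturated chart
  have hlift : ∀ (D : Type) [CommRing D] (ψ : MvPolynomial (Fin 3 × Fin 3) (ZMod p) →+* D),
      ψ (X (0,0) * X (1,1) * X (2,2) - X (0,0) * X (1,2) * X (2,1)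
        - X (0,1) * X (1,0) * X (2,2) + X (0,1) * X (1,2) * X (2,0)
        + X (0,2) * X (1,0) * X (2,1) - X (0,2) * X (1,1) * X (2,0)) = 0 →
      ψ (X (0,0) * X (1,2) - X (0,2) * X (1,0)) = 0 →
      ψ (X (0,2)) = 0 → ψ (X (1,0)) = 0 → ψ (X (2,1)) = 0 →
      IsUnit (ψ (X (0,1) * X (2,0) * X (1,1) * X (2,2))) →
      ∃ φ : Localization.Away g →+* D, ∀ a, φ (ιT a) = ψ a := by
    intro D _ ψ k1 k2 k3 k4 k5 k6
    have hker₀ : ∀ a ∈ Ideal.span (x '' Γ₀), ψ a = 0 := by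
      have hle : Ideal.span (x '' Γ₀) ≤ RingHom.ker ψ := by
        rw [hI₀, Ideal.span_le]
        rintro a ha
        simp only [Set.mem_insert_iff, Set.mem_singleton_iff] at ha
        rcases ha with rfl | rfl | rfl | rfl | rfl <;>
          simp only [SetLike.mem_coe, RingHom.mem_ker, map_neg, neg_eq_zero, k1, k2, k3, k4, k5]
      exact fun a ha => hle ha
    obtain ⟨ψ₀, hψ₀⟩ : ∃ ψ₀ : (MvPolynomial (Fin 3 × Fin 3) (ZMod p) ⧸ Ideal.span (x '' Γ₀)) →+* D,
        ∀ a, ψ₀ (Ideal.Quotient.mk _ a) = ψ a :=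
      ⟨Ideal.Quotient.lift _ ψ hker₀, fun a => Ideal.Quotient.lift_mk _ _ _⟩
    have hu₀ : IsUnit (ψ₀ g₀) := by
      show IsUnit (ψ₀ (Ideal.Quotient.mk _ _))
      rw [hψ₀]; exact k6
    obtain ⟨ψL, hψL⟩ : ∃ ψL : Localization.Away g₀ →+* D,
        ∀ b, ψL (algebraMap _ _ b) = ψ₀ b :=
      ⟨IsLocalization.Away.lift g₀ hu₀, fun b => IsLocalization.Away.lift_eq g₀ hu₀ b⟩
    have hkerΓ : ∀ a ∈ Ideal.span (x '' Γ), ψ a = 0 := by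
      have hle : Ideal.span (x '' Γ) ≤ RingHom.ker ψ := by
        rw [Ideal.span_le]
        rintro _ ⟨u, hu, rfl⟩
        have hu' : algebraMap _ (Localization.Away g₀) (Ideal.Quotient.mk _ (x u)) = 0 := hu
        rw [SetLike.mem_coe, RingHom.mem_ker, ← hψ₀, ← hψL, hu', map_zero]
      exact fun a ha => hle ha
    obtain ⟨ψQ, hψQ⟩ : ∃ ψQ : (MvPolynomial (Fin 3 × Fin 3) (ZMod p) ⧸ Ideal.span (x '' Γ)) →+* D,
        ∀ a, ψQ (Ideal.Quotient.mk _ a) = ψ a :=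
      ⟨Ideal.Quotient.lift _ ψ hkerΓ, fun a => Ideal.Quotient.lift_mk _ _ _⟩
    have huQ : IsUnit (ψQ g) := by
      show IsUnit (ψQ (Ideal.Quotient.mk _ _))
      rw [hψQ]; exact k6
    refine ⟨IsLocalization.Away.lift g huQ, fun a => ?_⟩
    rw [hιT, IsLocalization.Away.lift_eq, hψQ]
  have hext : ∀ (D : Type) [CommRing D] (φ₁ φ₂ : Localization.Away g →+* D),
      (∀ a, φ₁ (ιT a) = φ₂ (ιT a)) → φ₁ = φ₂ := by
    intro D _ φ₁ φ₂ h
    apply IsLocalization.ringHom_ext (Submonoid.powers g)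
    apply Ideal.Quotient.ringHom_ext
    exact RingHom.ext h
  -- consequences (§1–§2)
  have hnil := isNilpotent_ywu_of_relations ιT h1 h2 h3 h4 h5
  have hkey := mem_of_mul_ywu_eq_zero ιT h1 h2 h3 h4 h5 hunit hlift hext
  haveI : Nontrivial (Localization.Away g) := nontrivial_of_lift ιT hlift
  refine ⟨?_, ?_, ?_, ?_, ?_⟩
  · -- `Q_Γ` is not a domain: `f = ywu` has `f² = 0` there but `f ≠ 0` (its image in `T` is `≠ 0`)
    intro hdomQ
    haveI := hdomQ
    have q0 : ∀ a ∈ Ideal.span (x '' Γ₀),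
        Ideal.Quotient.mk (Ideal.span (x '' Γ)) a = 0 := fun a ha =>
      Ideal.Quotient.eq_zero_iff_mem.mpr (hII ha)
    have hnilQ := isNilpotent_ywu_of_relations (Ideal.Quotient.mk (Ideal.span (x '' Γ)))
      (q0 _ hg1) (q0 _ hg2) (q0 _ hg3) (q0 _ hg4) (q0 _ hg5)
    have hf0 : Ideal.Quotient.mk (Ideal.span (x '' Γ)) (X (0,1) * X (1,2) * X (2,0)) = 0 :=
      hnilQ.eq_zero
    obtain ⟨m, hm⟩ := Ideal.exists_maximal (Localization.Away g)
    have h1mem := hkey ⟨m, hm.isPrime⟩ 1 (by rw [one_mul, hιT, hf0, map_zero])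
    exact hm.ne_top ((Ideal.eq_top_iff_one _).mpr h1mem)
  · -- saturation: `β : T → L` over `𝔽_p[A]`; for `u ∉ Γ`, `β (x_u) = x_u ≠ 0` in `L`
    intro u hu h0
    obtain ⟨β, hβ⟩ := hlift (Localization.Away g₀)
      ((algebraMap _ (Localization.Away g₀)).comp (Ideal.Quotient.mk (Ideal.span (x '' Γ₀))))
      (by rw [RingHom.comp_apply, Ideal.Quotient.eq_zero_iff_mem.mpr hg1, map_zero])
      (by rw [RingHom.comp_apply, Ideal.Quotient.eq_zero_iff_mem.mpr hg2, map_zero])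
      (by rw [RingHom.comp_apply, Ideal.Quotient.eq_zero_iff_mem.mpr hg3, map_zero])
      (by rw [RingHom.comp_apply, Ideal.Quotient.eq_zero_iff_mem.mpr hg4, map_zero])
      (by rw [RingHom.comp_apply, Ideal.Quotient.eq_zero_iff_mem.mpr hg5, map_zero])
      (IsLocalization.Away.algebraMap_isUnit g₀)
    have h0' : ιT (x u) = 0 := h0
    have e := hβ (x u)
    rw [h0', map_zero, RingHom.comp_apply] at e
    exact hu e.symm
  · exact not_isRegularRing_of_nilpotent_of_key _ hnil hkey
  · intro hdim
    have e : topologicalKrullDim (Spec (.of (Localization.Away g))) =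
        ringKrullDim (Localization.Away g) :=
      PrimeSpectrum.topologicalKrullDim_eq_ringKrullDim (Localization.Away g)
    have h2 := (two_le_ringKrullDim_of_lift ιT hlift).trans (e ▸ hdim)
    norm_num at h2
  · exact not_hasResolution_of_nilpotent_of_key _ hnil hkey

/-- **`hdom` is load-bearing in the residue stub (N): it cannot be dropped.** The registered stub
`stub_saturatedEngineNonintegral` of line `birth` (crux `UniversalCells.MatroidCellRes`) with its
hypothesis `hdom : IsDomain (Localization.Away g)` REMOVED — "for `p` prime, `Q_Γ` not a domain,
`Γ` saturated on `D(g)`, `(Q_Γ)_g` not regular and of dimension `≥ 2`, the chart `Spec (Q_Γ)_g` has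
a resolution" — is FALSE (`…_at` at `p = 2`; every prime works). Saturation, non-integrality of
`Z_Γ`, singularity and dimension do not substitute for integrality of the chart: any proof of (N),
or of the saturated engine S⁺₁, must use `hdom`. [folklore] -/
theorem stub_saturatedEngineNonintegral_false_without_hdom :
    ¬ ∀ p : ℕ, p.Prime → ∀ (m : ℕ) (Γ : Set (Fin 3 → Fin 3 ⊕ Fin m)),
      ¬ IsDomain (MvPolynomial (Fin 3 × Fin m) (ZMod p) ⧸ Ideal.span ((fun u : Fin 3 → Fin 3 ⊕ Fin m => ((Matrix.fromCols (1 : Matrix (Fin 3) (Fin 3) (MvPolynomial (Fin 3 × Fin m) (ZMod p))) (Matrix.of fun i j => MvPolynomial.X (i, j))).submatrix id u).det) '' Γ)) →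
      ∀ (g : MvPolynomial (Fin 3 × Fin m) (ZMod p) ⧸ Ideal.span ((fun u : Fin 3 → Fin 3 ⊕ Fin m => ((Matrix.fromCols (1 : Matrix (Fin 3) (Fin 3) (MvPolynomial (Fin 3 × Fin m) (ZMod p))) (Matrix.of fun i j => MvPolynomial.X (i, j))).submatrix id u).det) '' Γ)),
        (∀ u : Fin 3 → Fin 3 ⊕ Fin m, u ∉ Γ →
            algebraMap (MvPolynomial (Fin 3 × Fin m) (ZMod p) ⧸ Ideal.span ((fun u : Fin 3 → Fin 3 ⊕ Fin m => ((Matrix.fromCols (1 : Matrix (Fin 3) (Fin 3) (MvPolynomial (Fin 3 × Fin m) (ZMod p))) (Matrix.of fun i j => MvPolynomial.X (i, j))).submatrix id u).det) '' Γ)) (Localization.Away g)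
              (Ideal.Quotient.mk (Ideal.span ((fun u : Fin 3 → Fin 3 ⊕ Fin m => ((Matrix.fromCols (1 : Matrix (Fin 3) (Fin 3) (MvPolynomial (Fin 3 × Fin m) (ZMod p))) (Matrix.of fun i j => MvPolynomial.X (i, j))).submatrix id u).det) '' Γ))
                ((Matrix.fromCols (1 : Matrix (Fin 3) (Fin 3) (MvPolynomial (Fin 3 × Fin m) (ZMod p))) (Matrix.of fun i j => MvPolynomial.X (i, j))).submatrix id u).det) ≠ 0) →
          ¬ IsRegularRing (Localization.Away g) →
            ¬ topologicalKrullDim (Spec (.of (Localization.Away g))) ≤ 1 →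
              Scheme.HasResolution (Spec (.of (Localization.Away g))) := by
  intro H
  obtain ⟨m, Γ, g, hnd, hsat, hsing, hdim, hres⟩ :=
    stub_saturatedEngineNonintegral_false_without_hdom_at 2 Nat.prime_two
  exact hres (H 2 Nat.prime_two m Γ hnd g hsat hsing hdim)

end Residue

/-! ## §4 Hu's claim (H) without `IsDomain` is false -/

section HuClaim

/-- **Witness, at every prime `p`, against Hu's claim with `IsDomain` dropped**: the Γ-scheme
`Z_{Γ₀} = Spec (HuGamma.ring 𝔽_p 3 Γ₀)` of generation 1 admits no proper birational `Z' → Z_{Γ₀}`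
with `Z'` smooth over `𝔽_p`. Such a `Z'` would be regular (`Scheme.IsRegular.of_smooth` over the
regular `Spec 𝔽_p`), i.e. `Z_{Γ₀}` would have a resolution, and so would its open chart
`Spec (Q_{Γ₀})_{g₀}` (`Scheme.HasResolution.of_isOpenImmersion`) — which is presented by the five
relations and the unit `g₀`, hence has none (§1–§2). [folklore] -/
theorem hu2025Thm13_false_without_isDomain_at (p : ℕ) [Fact p.Prime] :
    ¬ ∀ (m : ℕ) (Γ : Set (Fin 3 → Fin 3 ⊕ Fin m)),
        ∃ (Z' : Scheme.{0}) (π : Z' ⟶ Spec (.of (HuGamma.ring (ZMod p) m Γ))),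
          IsProper π ∧ IsBirational π ∧ Smooth (π ≫ HuGamma.toBase (ZMod p) m Γ) := by
  intro H
  classical
  let Γ₀ : Set (Fin 3 → Fin 3 ⊕ Fin 3) := {![Sum.inr 0, Sum.inr 1, Sum.inr 2],
      ![Sum.inl 2, Sum.inr 0, Sum.inr 2], ![Sum.inl 1, Sum.inl 2, Sum.inr 2],
      ![Sum.inl 0, Sum.inl 2, Sum.inr 0], ![Sum.inl 0, Sum.inl 1, Sum.inr 1]}
  obtain ⟨Z', π, hπ, hbir, hsm⟩ := H 3 Γ₀
  have hres : Scheme.HasResolution (Spec (.of (HuGamma.ring (ZMod p) 3 Γ₀))) := by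
    haveI := hsm
    exact ⟨Z', π, hπ, hbir,
      Scheme.IsRegular.of_smooth (π ≫ HuGamma.toBase (ZMod p) 3 Γ₀) (Scheme.isRegular_Spec _)⟩
  -- the open chart `L = (Q_{Γ₀})_{g₀}`
  let g₀ : HuGamma.ring (ZMod p) 3 Γ₀ := Ideal.Quotient.mk _ (X (0,1) * X (2,0) * X (1,1) * X (2,2))
  haveI : IsOpenImmersion (Spec.map (CommRingCat.ofHom
      (algebraMap (HuGamma.ring (ZMod p) 3 Γ₀) (Localization.Away g₀)))) :=
    IsOpenImmersion.of_isLocalization g₀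
  have hresL : Scheme.HasResolution (Spec (.of (Localization.Away g₀))) :=
    hres.of_isOpenImmersion (Spec.map (CommRingCat.ofHom
      (algebraMap (HuGamma.ring (ZMod p) 3 Γ₀) (Localization.Away g₀))))
  -- its presentation
  have hI₀ : HuGamma.ideal (ZMod p) 3 Γ₀ = Ideal.span {X (0,0) * X (1,1) * X (2,2) - X (0,0) * X (1,2) * X (2,1)
        - X (0,1) * X (1,0) * X (2,2) + X (0,1) * X (1,2) * X (2,0)
        + X (0,2) * X (1,0) * X (2,1) - X (0,2) * X (1,1) * X (2,0),
      X (0,0) * X (1,2) - X (0,2) * X (1,0), X (0,2), - X (1,0), X (2,1)} := by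
    unfold HuGamma.ideal HuGamma.minor HuGamma.frameMatrix
    exact gammaIdeal_example_eq p
  let ιL : MvPolynomial (Fin 3 × Fin 3) (ZMod p) →+* Localization.Away g₀ :=
    (algebraMap _ (Localization.Away g₀)).comp (Ideal.Quotient.mk (HuGamma.ideal (ZMod p) 3 Γ₀))
  have hιL : ∀ a, ιL a = algebraMap (HuGamma.ring (ZMod p) 3 Γ₀) (Localization.Away g₀)
      (Ideal.Quotient.mk (HuGamma.ideal (ZMod p) 3 Γ₀) a) := fun a => rfl
  have hmem : ∀ a : MvPolynomial (Fin 3 × Fin 3) (ZMod p), a ∈ ({X (0,0) * X (1,1) * X (2,2) - X (0,0) * X (1,2) * X (2,1)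
        - X (0,1) * X (1,0) * X (2,2) + X (0,1) * X (1,2) * X (2,0)
        + X (0,2) * X (1,0) * X (2,1) - X (0,2) * X (1,1) * X (2,0),
      X (0,0) * X (1,2) - X (0,2) * X (1,0), X (0,2), - X (1,0), X (2,1)} : Set (MvPolynomial (Fin 3 × Fin 3) (ZMod p))) →
      a ∈ HuGamma.ideal (ZMod p) 3 Γ₀ := fun a ha => by
    rw [hI₀]; exact Ideal.subset_span ha
  have hkill : ∀ a ∈ HuGamma.ideal (ZMod p) 3 Γ₀, ιL a = 0 := fun a ha => by
    rw [hιL, Ideal.Quotient.eq_zero_iff_mem.mpr ha, map_zero]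
  have h1 := hkill (X (0,0) * X (1,1) * X (2,2) - X (0,0) * X (1,2) * X (2,1)
        - X (0,1) * X (1,0) * X (2,2) + X (0,1) * X (1,2) * X (2,0)
        + X (0,2) * X (1,0) * X (2,1) - X (0,2) * X (1,1) * X (2,0)) (hmem _ (by simp))
  have h2 := hkill (X (0,0) * X (1,2) - X (0,2) * X (1,0)) (hmem _ (by simp))
  have h3 := hkill (X (0,2)) (hmem _ (by simp))
  have h4 : ιL (X (1,0)) = 0 := by
    have h := hkill (- X (1,0)) (hmem _ (by simp))
    rwa [map_neg, neg_eq_zero] at h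
  have h5 := hkill (X (2,1)) (hmem _ (by simp))
  have hunit : IsUnit (ιL (X (0,1) * X (2,0) * X (1,1) * X (2,2))) :=
    IsLocalization.Away.algebraMap_isUnit g₀
  have hlift : ∀ (D : Type) [CommRing D] (ψ : MvPolynomial (Fin 3 × Fin 3) (ZMod p) →+* D),
      ψ (X (0,0) * X (1,1) * X (2,2) - X (0,0) * X (1,2) * X (2,1)
        - X (0,1) * X (1,0) * X (2,2) + X (0,1) * X (1,2) * X (2,0)
        + X (0,2) * X (1,0) * X (2,1) - X (0,2) * X (1,1) * X (2,0)) = 0 →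
      ψ (X (0,0) * X (1,2) - X (0,2) * X (1,0)) = 0 →
      ψ (X (0,2)) = 0 → ψ (X (1,0)) = 0 → ψ (X (2,1)) = 0 →
      IsUnit (ψ (X (0,1) * X (2,0) * X (1,1) * X (2,2))) →
      ∃ φ : Localization.Away g₀ →+* D, ∀ a, φ (ιL a) = ψ a := by
    intro D _ ψ k1 k2 k3 k4 k5 k6
    have hker₀ : ∀ a ∈ HuGamma.ideal (ZMod p) 3 Γ₀, ψ a = 0 := by
      have hle : HuGamma.ideal (ZMod p) 3 Γ₀ ≤ RingHom.ker ψ := by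
        rw [hI₀, Ideal.span_le]
        rintro a ha
        simp only [Set.mem_insert_iff, Set.mem_singleton_iff] at ha
        rcases ha with rfl | rfl | rfl | rfl | rfl <;>
          simp only [SetLike.mem_coe, RingHom.mem_ker, map_neg, neg_eq_zero, k1, k2, k3, k4, k5]
      exact fun a ha => hle ha
    obtain ⟨ψ₀, hψ₀⟩ : ∃ ψ₀ : HuGamma.ring (ZMod p) 3 Γ₀ →+* D,
        ∀ a, ψ₀ (Ideal.Quotient.mk _ a) = ψ a :=
      ⟨Ideal.Quotient.lift _ ψ hker₀, fun a => Ideal.Quotient.lift_mk _ _ _⟩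
    have hu₀ : IsUnit (ψ₀ g₀) := by
      show IsUnit (ψ₀ (Ideal.Quotient.mk _ _))
      rw [hψ₀]; exact k6
    refine ⟨IsLocalization.Away.lift g₀ hu₀, fun a => ?_⟩
    rw [hιL, IsLocalization.Away.lift_eq, hψ₀]
  have hext : ∀ (D : Type) [CommRing D] (φ₁ φ₂ : Localization.Away g₀ →+* D),
      (∀ a, φ₁ (ιL a) = φ₂ (ιL a)) → φ₁ = φ₂ := by
    intro D _ φ₁ φ₂ h
    apply IsLocalization.ringHom_ext (Submonoid.powers g₀)
    apply Ideal.Quotient.ringHom_ext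
    exact RingHom.ext h
  have hnil := isNilpotent_ywu_of_relations ιL h1 h2 h3 h4 h5
  have hkey := mem_of_mul_ywu_eq_zero ιL h1 h2 h3 h4 h5 hunit hlift hext
  haveI : Nontrivial (Localization.Away g₀) := nontrivial_of_lift ιL hlift
  exact not_hasResolution_of_nilpotent_of_key _ hnil hkey hresL

/-- **`IsDomain` is load-bearing in Hu's claim (H): it cannot be dropped.** The Literature claim
`Hu2025IntegralGammaSchemeResolution` (Hu 2025, Thm. 1.3 by name; stub (H) `stub_hu2025Thm13` of
line `birth` of crux `UniversalCells.MatroidCellRes`) with its hypothesis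
`IsDomain (HuGamma.ring (ZMod p) m Γ)` REMOVED — "every Γ-scheme over `𝔽_p` has a proper
birational `Z' → Z_Γ` with `Z'` smooth over `𝔽_p`" — is FALSE: the six-column Γ-scheme of
generation 1 is generically non-reduced along a component (`…_at`, every prime). Under the summit
the hypothesis can be weakened to `IsReduced` (then `Z_Γ` is a reduced separated 𝔽_p-scheme of
finite type), not removed; it is the hypothesis Hu's Lemma 7.3 consumes. [folklore] -/
theorem hu2025Thm13_false_without_isDomain :
    ¬ ∀ (p : ℕ) [Fact p.Prime] (m : ℕ) (Γ : Set (Fin 3 → Fin 3 ⊕ Fin m)),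
        ∃ (Z' : Scheme.{0}) (π : Z' ⟶ Spec (.of (HuGamma.ring (ZMod p) m Γ))),
          IsProper π ∧ IsBirational π ∧ Smooth (π ≫ HuGamma.toBase (ZMod p) m Γ) := by
  intro H
  haveI : Fact (Nat.Prime 2) := ⟨Nat.prime_two⟩
  exact hu2025Thm13_false_without_isDomain_at 2 (H 2)

end HuClaim

end Summit.ResolutionOfSingularities.ResolutionOfSingularities.Theorems.MatroidCellRes.Negative

end
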